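import Summits.QuantumAdvantage.AdviceFreeQNC0.AffBells21Characters
import Summits.QuantumAdvantage.AdviceFreeQNC0.AffBells21Descent
import HarnessLib

/-!
# Cell qa-qnc0, the GEOMETRIC MODEL of plan S2 (ROUND-21 §1): affine hyperplane systems in `𝔽₃^m` — separation count
and the coordinate-free Cauchy–Schwarz — planner qa-qnc0-p1 g22, `Sketch22.lean` §1/§2, statements VERBATIM

Support for crux `RingDenseResidualLt3` (stmt-QuantumAdvantage-22907), route `DWalkThree`, rung candidate
`RingFrameAffineLt3`.  Objects VERBATIM from the planner's `exp22/Sketch22.lean`: `geoHits`, `geoBiasNum` (the integer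
numerator `Σ_{u ∈ 𝔽₃^m} (−1)^{hits(u)}` of the geometric bias of a hyperplane system `(M, ρ)`), `geoKerSum`,
`GeoKernelFormula`, `geoChildM`, `geoChildR`, `GeoDescent`, `SeparationCount`.

PROVED here (0 sorry):
* `three_mul_card_level` — an affine hyperplane `⟨ξ, u⟩ = c` (`ξ ≠ 0`) of `𝔽₃^s` has exactly `3^{s−1}` points
  (orthogonality of characters, `TwoModuli.sum_stdAddChar_dot_eq_ite`);
* **`separationCount : SeparationCount`** — if some `M_k ≠ 0`, two independent uniform points of `𝔽₃^m` are separated by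
  the system with probability `≥ 1/3` (`3·#unseparated ≤ 2·9^m`: unseparated pairs lie in `H × H ∪ Hᶜ × Hᶜ` for the
  hyperplane `H` of row `k`, `|H| = 3^{m−1}`, `5·9^{m−1} ≤ (2/3)9^m`);
* **`geoDescent : GeoDescent`** — `3·N² ≤ 9^m + 2·3^m·|N_child|`: average over the lines `u + 𝔽₃·d`, Cauchy–Schwarz,
  translation invariance of `Σ_u`, and the third-residue merge of `AffBells21.row_pair_mod_two` on each surviving row
  (`sign_geo_shift`: `f(u)f(u+d) = ± (−1)^{hits_child(u)}`).

WHAT THIS IS NOT: the kernel formula `GeoKernelFormula` is stated here and proved in `AffBells22GeoKernel.lean`; the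
frame expansion (SPAN-Φ) and the ring statements of Sketch22 §2 are elsewhere; nothing here touches the crux.
-/

namespace Summit.QuantumAdvantage.AdviceFreeQNC0

open Finset
open Literature.Computability.MetaComplexity

namespace AffBells22

/-! ## §1 statements (planner qa-qnc0-p1 g22, Sketch22.lean §1 — VERBATIM) -/

/-- Number of hyperplanes `⟨M_k, u⟩ = ρ_k` of the system `(M, ρ)` passing through the point `u ∈ 𝔽₃^m`. -/
def geoHits (m s : ℕ) (M : Fin s → Fin m → ZMod 3) (ρ : Fin s → ZMod 3) (u : Fin m → ZMod 3) : ℕ :=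
  (univ.filter fun k : Fin s => (∑ i : Fin m, M k i * u i) = ρ k).card

/-- Integer numerator of the GEOMETRIC BIAS: `geoBiasNum = Σ_{u ∈ 𝔽₃^m} (−1)^{hits(u)}`, `geobias = geoBiasNum / 3^m`. -/
def geoBiasNum (m s : ℕ) (M : Fin s → Fin m → ZMod 3) (ρ : Fin s → ZMod 3) : ℤ :=
  ∑ u : Fin m → ZMod 3, (-1 : ℤ) ^ geoHits m s M ρ u

/-- Kernel side of the kernel formula: `Σ_{ξ ∈ 𝔽₃^s, ξM = 0} (−2)^{wt ξ} · (2 if ⟨ξ,ρ⟩ = 0, −1 otherwise)`. -/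
def geoKerSum (m s : ℕ) (M : Fin s → Fin m → ZMod 3) (ρ : Fin s → ZMod 3) : ℤ :=
  ∑ ξ : Fin s → ZMod 3,
    if (∀ i : Fin m, (∑ k : Fin s, ξ k * M k i) = 0) then
      (-2 : ℤ) ^ (univ.filter fun k : Fin s => ξ k ≠ 0).card * (if (∑ k : Fin s, ξ k * ρ k) = 0 then 2 else -1)
    else 0

/-- **KERNEL FORMULA** (support; Fourier on `𝔽₃^m`: `(−1)^{[ℓ=ρ]} = (1/3)Σ_{ξ∈𝔽₃}(1 − 3[ξ=0])·… `, i.e.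
`(−1)^{[a=0]} = 1/3·(1) − 2/3·(ω^a + ω^{−a})`, product over rows, orthogonality in `u`; the phase sum over the scalings of a
kernel vector is `2·[⟨ξ,ρ⟩=0] − [≠0]`):  `2·3^s·geoBiasNum = 3^m·geoKerSum`.  Consequences: `s` independent normals ⇒
`geobias = ±3^{-s}` exactly; the bias of a frame system is carried ENTIRELY by the left kernel of the coefficient matrix `M`
(kit j300029 part C: 200/200 random instances exact). -/
def GeoKernelFormula : Prop :=
  ∀ (m s : ℕ) (M : Fin s → Fin m → ZMod 3) (ρ : Fin s → ZMod 3),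
    2 * 3 ^ s * geoBiasNum m s M ρ = 3 ^ m * geoKerSum m s M ρ

/-- Child of the GEOMETRIC Cauchy–Schwarz in direction `d`: rows with `a_k := ⟨M_k, d⟩ ≠ 0` survive (others become the
zero row, made vacuous below). -/
def geoChildM {m s : ℕ} (M : Fin s → Fin m → ZMod 3) (d : Fin m → ZMod 3) : Fin s → Fin m → ZMod 3 :=
  fun k => if (∑ i : Fin m, M k i * d i) ≠ 0 then M k else 0

/-- Child residues: the THIRD residue `ρ_k + a_k` on survivors (`[ℓ=ρ] + [ℓ+a=ρ] ≡ 1 + [ℓ = ρ+a]`); `1` (never hit by the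
zero row) otherwise. -/
def geoChildR {m s : ℕ} (M : Fin s → Fin m → ZMod 3) (ρ : Fin s → ZMod 3) (d : Fin m → ZMod 3) : Fin s → ZMod 3 :=
  fun k => if (∑ i : Fin m, M k i * d i) ≠ 0 then ρ k + ∑ i : Fin m, M k i * d i else 1

/-- **GEOMETRIC CAUCHY–SCHWARZ** (support; average over the lines `ū + 𝔽₃·d`, Cauchy–Schwarz, the cross terms
`E_u f(u)f(u+d)` kill the rows with `⟨M_k,d⟩ = 0` and turn the others into `[⟨M_k,u⟩ = ρ_k + a_k]`):
`geobias(M,ρ)² ≤ 1/3 + (2/3)|geobias(child_d)|`, i.e. `3·N² ≤ 9^m + 2·3^m·|N_child|` for the numerators.  No coordinate of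
the cube is consumed (contrast (DL)); for a subgroup `H ≤ 𝔽₃^m`: `geobias² ≤ 3^{−dim H} + E_{d ∈ H∖0}|geobias(child_d)|`.
Kit j300029 part E: 300/300, equality attained. -/
def GeoDescent : Prop :=
  ∀ (m s : ℕ) (M : Fin s → Fin m → ZMod 3) (ρ : Fin s → ZMod 3) (d : Fin m → ZMod 3), d ≠ 0 →
    3 * (geoBiasNum m s M ρ) ^ 2 ≤ 9 ^ m + 2 * 3 ^ m * |geoBiasNum m s (geoChildM M d) (geoChildR M ρ d)|

/-- **SEPARATION COUNT** (support, the combinatorial heart of §2, pure `𝔽₃^m` counting): if some row is a genuine hyperplane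
(`M_k ≠ 0`), then two independent uniform points of `𝔽₃^m` are separated by at least one row of the system with probability
`≥ 1/3`:  `9^m − #{(u,u') : Sep₀(u,u') = ∅} ≥ 9^m / 3`, i.e. `3·#{unseparated pairs} ≤ 2·9^m`. -/
def SeparationCount : Prop :=
  ∀ (m N : ℕ) (M : Fin N → Fin m → ZMod 3) (c : Fin N → ZMod 3), (∃ k, M k ≠ 0) →
    3 * ((univ : Finset ((Fin m → ZMod 3) × (Fin m → ZMod 3))).filter fun p =>
          ∀ k : Fin N, ((∑ i : Fin m, M k i * p.1 i) = c k ↔ (∑ i : Fin m, M k i * p.2 i) = c k)).card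
      ≤ 2 * 9 ^ m

/-! ## Affine hyperplanes of `𝔽₃^s` have `3^{s−1}` points -/

variable {m s : ℕ}

/-- **Level sets of a non-zero linear form**: `3 · #{u ∈ 𝔽₃^s : ⟨ξ, u⟩ = c} = 3^s` for `ξ ≠ 0` and every `c`. -/
theorem three_mul_card_level (ξ : Fin s → ZMod 3) (hξ : ξ ≠ 0) (c : ZMod 3) :
    3 * (univ.filter fun u : Fin s → ZMod 3 => (∑ k, ξ k * u k) = c).card = 3 ^ s := by
  -- the count as a character sum, in `ℂ`
  have hind : ∀ u : Fin s → ZMod 3, (if (∑ k, ξ k * u k) = c then (3 : ℂ) else 0)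
      = ∑ t : ZMod 3, (ZMod.stdAddChar (-(t * c)) : ℂ) * (ZMod.stdAddChar (∑ k, u k * (ξ k * t)) : ℂ) := by
    intro u
    have h := AffBells21.sum_stdAddChar_three ((∑ k, ξ k * u k) - c)
    have hre : ∑ t : ZMod 3, (ZMod.stdAddChar (-(t * c)) : ℂ) * (ZMod.stdAddChar (∑ k, u k * (ξ k * t)) : ℂ)
        = ∑ a : ZMod 3, (ZMod.stdAddChar (((∑ k, ξ k * u k) - c) * a) : ℂ) := by
      refine sum_congr rfl fun t _ => ?_
      rw [← AddChar.map_add_eq_mul]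
      congr 1
      rw [sub_mul, sum_mul]
      have : ∑ k, ξ k * u k * t = ∑ k, u k * (ξ k * t) := sum_congr rfl fun k _ => by ring
      rw [this]
      ring
    rw [hre, h]
    by_cases hP : (∑ k, ξ k * u k) = c
    · rw [if_pos hP, if_pos (sub_eq_zero.mpr hP)]
    · rw [if_neg hP, if_neg (fun h0 => hP (sub_eq_zero.mp h0))]
  have hC : (3 : ℂ) * ((univ.filter fun u : Fin s → ZMod 3 => (∑ k, ξ k * u k) = c).card : ℂ) = (3 : ℂ) ^ s := by
    have h1 : (3 : ℂ) * ((univ.filter fun u : Fin s → ZMod 3 => (∑ k, ξ k * u k) = c).card : ℂ)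
        = ∑ u : Fin s → ZMod 3, (if (∑ k, ξ k * u k) = c then (3 : ℂ) else 0) := by
      rw [Finset.sum_ite, sum_const_zero, add_zero, sum_const, nsmul_eq_mul, mul_comm]
    rw [h1, sum_congr rfl fun u _ => hind u, sum_comm]
    simp_rw [← mul_sum]
    have h2 : ∀ t : ZMod 3, ∑ u : Fin s → ZMod 3, (ZMod.stdAddChar (∑ k, u k * (ξ k * t)) : ℂ)
        = if t = 0 then (3 : ℂ) ^ s else 0 := by
      intro t
      rw [TwoModuli.sum_stdAddChar_dot_eq_ite (fun k => ξ k * t)]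
      by_cases ht : t = 0
      · subst ht
        have h0 : (fun k => ξ k * (0 : ZMod 3)) = 0 := funext fun k => by simp
        rw [if_pos h0, if_pos rfl]
        push_cast
        rfl
      · have hne : (fun k => ξ k * t) ≠ 0 := by
          intro h0
          apply hξ
          funext k
          have := congrFun h0 k
          simp only [Pi.zero_apply, mul_eq_zero] at this
          rcases this with h | h
          · exact h
          · exact absurd h ht
        rw [if_neg hne, if_neg ht]
    simp_rw [h2, mul_ite, mul_zero]
    rw [Finset.sum_ite_eq' univ (0 : ZMod 3)]
    simp
  exact_mod_cast hC

/-! ## The separation count -/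

/-- **SEPARATION COUNT, PROVED.** -/
theorem separationCount : SeparationCount := by
  intro m N M c hM
  obtain ⟨k₀, hk₀⟩ := hM
  set H : Finset (Fin m → ZMod 3) := univ.filter fun u => (∑ i : Fin m, M k₀ i * u i) = c k₀ with hH
  have hlevel : 3 * H.card = 3 ^ m := three_mul_card_level (M k₀) hk₀ (c k₀)
  -- unseparated pairs agree on row k₀
  have hsub : ((univ : Finset ((Fin m → ZMod 3) × (Fin m → ZMod 3))).filter fun p =>
        ∀ k : Fin N, ((∑ i : Fin m, M k i * p.1 i) = c k ↔ (∑ i : Fin m, M k i * p.2 i) = c k))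
      ⊆ (H ×ˢ H) ∪ (Hᶜ ×ˢ Hᶜ) := by
    intro p hp
    rw [mem_filter] at hp
    have hk := hp.2 k₀
    rw [mem_union, mem_product, mem_product, mem_compl, mem_compl, hH, mem_filter, mem_filter]
    simp only [mem_univ, true_and]
    by_cases h1 : (∑ i : Fin m, M k₀ i * p.1 i) = c k₀
    · exact Or.inl ⟨h1, hk.mp h1⟩
    · exact Or.inr ⟨h1, fun h2 => h1 (hk.mpr h2)⟩
  have hcard := (card_le_card hsub).trans (card_union_le _ _)
  rw [card_product, card_product, card_compl, Fintype.card_fun, ZMod.card, Fintype.card_fin] at hcard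
  have hHle : H.card ≤ 3 ^ m := by
    calc H.card ≤ (univ : Finset (Fin m → ZMod 3)).card := card_le_univ _
      _ = 3 ^ m := by rw [card_univ, Fintype.card_fun, ZMod.card, Fintype.card_fin]
  have h9 : (9 : ℕ) ^ m = 3 ^ m * 3 ^ m := by rw [← mul_pow]; norm_num
  rw [h9]
  -- 3·(h² + (T − h)²) ≤ 2T² with T = 3h
  have key : 3 * (H.card * H.card + (3 ^ m - H.card) * (3 ^ m - H.card)) ≤ 2 * (3 ^ m * 3 ^ m) := by
    obtain ⟨T, hT⟩ : ∃ T, T = 3 ^ m := ⟨_, rfl⟩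
    rw [← hT] at hlevel hHle ⊢
    have hd : T - H.card = 2 * H.card := by omega
    rw [hd]
    nlinarith [hlevel]
  exact le_trans (Nat.mul_le_mul_left 3 hcard) key

/-! ## The coordinate-free Cauchy–Schwarz -/

/-- The sign of the system at a point. -/
def geoSign (M : Fin s → Fin m → ZMod 3) (ρ : Fin s → ZMod 3) (u : Fin m → ZMod 3) : ℤ := (-1 : ℤ) ^ geoHits m s M ρ u

/-- `⟨M_k, u + v⟩ = ⟨M_k, u⟩ + ⟨M_k, v⟩`. -/
theorem dot_add (Mk u v : Fin m → ZMod 3) :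
    (∑ i : Fin m, Mk i * (u + v) i) = (∑ i : Fin m, Mk i * u i) + ∑ i : Fin m, Mk i * v i := by
  rw [← sum_add_distrib]
  exact sum_congr rfl fun i _ => by rw [Pi.add_apply, mul_add]

/-- `⟨M_k, t • d⟩ = t · ⟨M_k, d⟩`. -/
theorem dot_smul (Mk d : Fin m → ZMod 3) (t : ZMod 3) :
    (∑ i : Fin m, Mk i * (t • d) i) = t * ∑ i : Fin m, Mk i * d i := by
  rw [mul_sum]
  exact sum_congr rfl fun i _ => by rw [Pi.smul_apply, smul_eq_mul]; ring

/-- The third-residue merge on one row, geometric form: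
`[ℓ = ρ] + [ℓ + a = ρ] ≡ [a ≠ 0] + [child row hit] (mod 2)`. -/
theorem geo_row_mod_two (a ℓ ρ : ZMod 3) :
    ((if ℓ = ρ then 1 else 0) + (if ℓ + a = ρ then 1 else 0) : ℕ) % 2
      = ((if a ≠ 0 then 1 else 0) + (if (if a ≠ 0 then ℓ else 0) = (if a ≠ 0 then ρ + a else 1) then 1 else 0) : ℕ) % 2 := by
  revert a ℓ ρ
  decide

/-- **Sign of a shift**: `f(u)·f(u + d) = (−1)^{#surv} · (−1)^{hits_child(u)}`. -/
theorem sign_geo_shift (M : Fin s → Fin m → ZMod 3) (ρ : Fin s → ZMod 3) (d u : Fin m → ZMod 3) :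
    geoSign M ρ u * geoSign M ρ (u + d)
      = (-1 : ℤ) ^ (univ.filter fun k : Fin s => (∑ i : Fin m, M k i * d i) ≠ 0).card
        * geoSign (geoChildM M d) (geoChildR M ρ d) u := by
  unfold geoSign geoHits
  rw [← pow_add, ← pow_add, neg_one_pow_eq_pow_mod_two, neg_one_pow_eq_pow_mod_two (n := _ + _)]
  congr 1
  rw [card_filter, card_filter, card_filter, card_filter, ← sum_add_distrib, ← sum_add_distrib, Finset.sum_nat_mod,
    Finset.sum_nat_mod (univ : Finset (Fin s)) 2 (fun k => _ + _)]
  congr 1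
  refine sum_congr rfl fun k _ => ?_
  have hrow : (∑ i : Fin m, geoChildM M d k i * u i) = if (∑ i : Fin m, M k i * d i) ≠ 0 then (∑ i : Fin m, M k i * u i)
      else 0 := by
    unfold geoChildM
    split_ifs <;> simp
  rw [dot_add, hrow]
  unfold geoChildR
  exact geo_row_mod_two _ _ _

/-- **GEOMETRIC CAUCHY–SCHWARZ, PROVED**: `3·N² ≤ 9^m + 2·3^m·|N_child_d|` for `d ≠ 0`
(and trivially for `d = 0` as well — the hypothesis is not used). -/
theorem geoDescent : GeoDescent := by
  intro m s M ρ d _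
  set f : (Fin m → ZMod 3) → ℤ := fun u => geoSign M ρ u with hf
  have hN : geoBiasNum m s M ρ = ∑ u, f u := rfl
  have hf1 : ∀ u, f u * f u = 1 := by
    intro u
    simp only [hf, geoSign, ← pow_add, ← two_mul]
    rw [pow_mul]
    norm_num
  -- averaging over the lines u + 𝔽₃·d
  set g : (Fin m → ZMod 3) → ℤ := fun u => ∑ t : ZMod 3, f (u + t • d) with hg
  have hshift : ∀ (c : Fin m → ZMod 3) (φ : (Fin m → ZMod 3) → ℤ), ∑ u, φ (u + c) = ∑ u, φ u :=
    fun c φ => Equiv.sum_comp (Equiv.addRight c) φ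
  have h3N : 3 * geoBiasNum m s M ρ = ∑ u, g u := by
    rw [hN, hg]
    simp only
    rw [sum_comm]
    simp_rw [hshift]
    rw [sum_const, card_univ, ZMod.card]
    simp
  -- Cauchy–Schwarz over the points
  have hCS : (∑ u, g u) ^ 2 ≤ (3 : ℤ) ^ m * ∑ u, g u ^ 2 := by
    have h := sq_sum_le_card_mul_sum_sq (s := (univ : Finset (Fin m → ZMod 3))) (f := g)
    rw [card_univ, Fintype.card_fun, ZMod.card, Fintype.card_fin] at h
    exact_mod_cast h
  -- the square of the line sum: 3·(C 0 + C 1 + C 2), C δ = Σ_u f(u) f(u + δ d)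
  set C : ZMod 3 → ℤ := fun δ => ∑ u, f u * f (u + δ • d) with hC
  have hsq : ∑ u, g u ^ 2 = 3 * ∑ δ : ZMod 3, C δ := by
    have hgu : ∀ u, g u ^ 2 = ∑ t : ZMod 3, ∑ t' : ZMod 3, f (u + t • d) * f (u + t' • d) := by
      intro u; rw [hg, sq, sum_mul_sum]
    rw [sum_congr rfl fun u _ => hgu u, sum_comm]
    have hinner : ∀ t : ZMod 3, ∑ u, ∑ t' : ZMod 3, f (u + t • d) * f (u + t' • d) = ∑ δ : ZMod 3, C δ := by
      intro t
      rw [sum_comm]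
      rw [← Equiv.sum_comp (Equiv.addRight t)]
      refine sum_congr rfl fun δ _ => ?_
      simp only [hC, Equiv.coe_addRight]
      rw [← hshift (t • d) (fun v => f v * f (v + δ • d))]
      refine sum_congr rfl fun u _ => ?_
      congr 2
      rw [add_smul]
      abel
    simp_rw [hinner]
    rw [sum_const, card_univ, ZMod.card]
    simp
  have hC0 : C 0 = (3 : ℤ) ^ m := by
    simp only [hC, zero_smul, add_zero, hf1]
    rw [sum_const, card_univ, Fintype.card_fun, ZMod.card, Fintype.card_fin]
    simp
  have hC2 : C 2 = C 1 := by
    simp only [hC]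
    rw [← hshift ((1 : ZMod 3) • d) (fun v => f v * f (v + (2 : ZMod 3) • d))]
    refine sum_congr rfl fun u _ => ?_
    rw [mul_comm, add_assoc, ← add_smul, show ((1 : ZMod 3) + 2) = 0 by decide, zero_smul, add_zero]
  -- the cross term is ± the child numerator
  have hC1 : C 1 = (-1 : ℤ) ^ (univ.filter fun k : Fin s => (∑ i : Fin m, M k i * d i) ≠ 0).card
      * geoBiasNum m s (geoChildM M d) (geoChildR M ρ d) := by
    simp only [hC, one_smul]
    unfold geoBiasNum
    rw [mul_sum]
    exact sum_congr rfl fun u _ => sign_geo_shift M ρ d u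
  have hC1le : C 1 ≤ |geoBiasNum m s (geoChildM M d) (geoChildR M ρ d)| := by
    rw [hC1]
    refine le_trans (le_abs_self _) ?_
    rw [abs_mul, abs_neg_one_pow, one_mul]
  have hsum3 : ∑ δ : ZMod 3, C δ = C 0 + C 1 + C 2 := by
    have h : (univ : Finset (ZMod 3)) = {0, 1, 2} := by decide
    rw [h, sum_insert (by decide), sum_insert (by decide), sum_singleton, add_assoc]
  -- assemble: 9N² = (Σ g)² ≤ 3^m · 3 · (3^m + 2 C1)
  have h9 : (9 : ℤ) ^ m = 3 ^ m * 3 ^ m := by rw [← mul_pow]; norm_num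
  have h3m : (0 : ℤ) ≤ 3 ^ m := by positivity
  rw [h9]
  have hmain : 9 * geoBiasNum m s M ρ ^ 2 ≤ 3 ^ m * (3 * (3 ^ m + 2 * C 1)) := by
    have : (3 * geoBiasNum m s M ρ) ^ 2 ≤ (3 : ℤ) ^ m * ∑ u, g u ^ 2 := by rw [h3N]; exact hCS
    rw [hsq, hsum3, hC0, hC2] at this
    nlinarith [this]
  nlinarith [hmain, hC1le, h3m, mul_le_mul_of_nonneg_left hC1le h3m]

end AffBells22

end Summit.QuantumAdvantage.AdviceFreeQNC0
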